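import Summits.QuantumFields.YangMills.Theorems.AtomicCalibrationRFactorialBookkeeping

/-!
# AtomicCalibrationR (stmt-QuantumFields-28169), E2 `stub_offDiagonalWhitney` — the `α Cⁿ (n!)^γ` budget algebra
# (roadmap v2 item B.3, total-mass bookkeeping; prover w4 g23, free hands)

`WhitneyPkg` allows the total Whitney mass the shape `α · Cⁿ · (n!)^γ · ‖F‖_{Nn}` with `α, C, γ` fixed before `n`.  Construction (T)
produces, level by level, explicit constants that are products of: numerals, `cⁿ`-type factors, `n^a`, the budget factorials
`((N'n)!)^b`, and `(1 + A n² + B n)^{p·n}` (from the rates `(1 + 2^{−k}R_k)^{N'n}`).  This file proves that all of these are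
ADMISSIBLE — bounded by `α Cⁿ (n!)^γ` for `n ≥ 1` (`γ` a natural number here) — and that admissibility is closed under products,
sums and domination; `exists_rpow_form` converts to the real-exponent shape of `WhitneyPkg`.  The predicate is spelled out in every
statement (no definitions).

Mathlib + `AtomicCalibrationRFactorialBookkeeping`; no stub/crux/rung/summit is closed; nothing here touches Yang–Mills; the YM mass gap
is NOT proved. [folklore]
-/

set_option autoImplicit false

noncomputable section

open scoped Nat
open Summit.QuantumFields.YangMills.Cruxes.AtomicCalibrationR.FactorialBookkeeping (pow_mul_self_le factorial_mul_le_admissible)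

namespace Summit.QuantumFields.YangMills.Cruxes.AtomicCalibrationR.Admissible

/-! ## Atoms -/

/-- A family dominated by a non-negative constant is admissible. -/
theorem of_le_const {f : ℕ → ℝ} {a : ℝ} (ha : 0 ≤ a) (hf : ∀ n : ℕ, 1 ≤ n → f n ≤ a) :
    ∃ α C : ℝ, ∃ γ : ℕ, 0 ≤ α ∧ 0 ≤ C ∧ ∀ n : ℕ, 1 ≤ n → f n ≤ α * C ^ n * (n ! : ℝ) ^ γ :=
  ⟨a, 1, 0, ha, zero_le_one, fun n hn => by rw [one_pow, pow_zero, mul_one, mul_one]; exact hf n hn⟩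

/-- A family dominated by `c^(p n + q)` (`c ≥ 0`) is admissible. -/
theorem of_le_pow {f : ℕ → ℝ} {c : ℝ} (hc : 0 ≤ c) (p q : ℕ) (hf : ∀ n : ℕ, 1 ≤ n → f n ≤ c ^ (p * n + q)) :
    ∃ α C : ℝ, ∃ γ : ℕ, 0 ≤ α ∧ 0 ≤ C ∧ ∀ n : ℕ, 1 ≤ n → f n ≤ α * C ^ n * (n ! : ℝ) ^ γ := by
  refine ⟨c ^ q, c ^ p, 0, pow_nonneg hc q, pow_nonneg hc p, fun n hn => ?_⟩
  rw [pow_zero, mul_one, ← pow_mul, ← pow_add, add_comm]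
  exact hf n hn

/-- A family dominated by `n^a` is admissible (`n^a ≤ (2^a)ⁿ`). -/
theorem of_le_natPow {f : ℕ → ℝ} (a : ℕ) (hf : ∀ n : ℕ, 1 ≤ n → f n ≤ (n : ℝ) ^ a) :
    ∃ α C : ℝ, ∃ γ : ℕ, 0 ≤ α ∧ 0 ≤ C ∧ ∀ n : ℕ, 1 ≤ n → f n ≤ α * C ^ n * (n ! : ℝ) ^ γ := by
  refine ⟨1, 2 ^ a, 0, zero_le_one, by positivity, fun n hn => ?_⟩
  have h2 : (n : ℝ) ≤ 2 ^ n := by exact_mod_cast Nat.lt_two_pow_self.le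
  rw [pow_zero, mul_one, one_mul, ← pow_mul, mul_comm, pow_mul]
  exact (hf n hn).trans (pow_le_pow_left₀ (Nat.cast_nonneg n) h2 a)

/-- A family dominated by a power of the budget factorial `((N'n)!)^b` is admissible. -/
theorem of_le_factorialMul {f : ℕ → ℝ} (N' b : ℕ) (hf : ∀ n : ℕ, 1 ≤ n → f n ≤ ((N' * n) ! : ℝ) ^ b) :
    ∃ α C : ℝ, ∃ γ : ℕ, 0 ≤ α ∧ 0 ≤ C ∧ ∀ n : ℕ, 1 ≤ n → f n ≤ α * C ^ n * (n ! : ℝ) ^ γ := by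
  refine ⟨1, ((N' : ℝ) * Real.exp 1) ^ (N' * b), N' * b, zero_le_one, by positivity, fun n hn => ?_⟩
  refine (hf n hn).trans ?_
  have h1 := factorial_mul_le_admissible N' n
  have h0 : (0 : ℝ) ≤ ((N' * n) ! : ℝ) := by positivity
  calc ((N' * n) ! : ℝ) ^ b ≤ (((N' : ℝ) * Real.exp 1) ^ (N' * n) * (n ! : ℝ) ^ N') ^ b := pow_le_pow_left₀ h0 h1 b
    _ = 1 * (((N' : ℝ) * Real.exp 1) ^ (N' * b)) ^ n * (n ! : ℝ) ^ (N' * b) := by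
        rw [one_mul, mul_pow, ← pow_mul, ← pow_mul, ← pow_mul]
        congr 1
        ring_nf

/-- A family dominated by `(1 + A n² + B n)^(p n)` (`A, B ≥ 0`) is admissible:
`(1 + A n² + B n)^(p n) ≤ ((1+A+B)^p)ⁿ · n^{2pn} ≤ ((1+A+B)^p e^{2p})ⁿ (n!)^{2p}`. -/
theorem of_le_quadPow {f : ℕ → ℝ} {A B : ℝ} (hA : 0 ≤ A) (hB : 0 ≤ B) (p : ℕ)
    (hf : ∀ n : ℕ, 1 ≤ n → f n ≤ (1 + A * (n : ℝ) ^ 2 + B * n) ^ (p * n)) :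
    ∃ α C : ℝ, ∃ γ : ℕ, 0 ≤ α ∧ 0 ≤ C ∧ ∀ n : ℕ, 1 ≤ n → f n ≤ α * C ^ n * (n ! : ℝ) ^ γ := by
  refine ⟨1, (1 + A + B) ^ p * Real.exp (((2 * p : ℕ) : ℝ)), 2 * p, zero_le_one, by positivity, fun n hn => ?_⟩
  refine (hf n hn).trans ?_
  have hn1 : (1 : ℝ) ≤ n := by exact_mod_cast hn
  have hn0 : (0 : ℝ) ≤ n := by positivity
  -- `1 + A n² + B n ≤ (1 + A + B) n²`
  have hbase : 1 + A * (n : ℝ) ^ 2 + B * n ≤ (1 + A + B) * (n : ℝ) ^ 2 := by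
    have h2 : (n : ℝ) ≤ (n : ℝ) ^ 2 := by nlinarith
    have h3 : (1 : ℝ) ≤ (n : ℝ) ^ 2 := by nlinarith
    nlinarith [mul_le_mul_of_nonneg_left h2 hB]
  have hbase0 : 0 ≤ 1 + A * (n : ℝ) ^ 2 + B * n := by positivity
  have hself := pow_mul_self_le (2 * p) n
  calc (1 + A * (n : ℝ) ^ 2 + B * n) ^ (p * n) ≤ ((1 + A + B) * (n : ℝ) ^ 2) ^ (p * n) :=
        pow_le_pow_left₀ hbase0 hbase _
    _ = ((1 + A + B) ^ p) ^ n * (n : ℝ) ^ (2 * p * n) := by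
        rw [mul_pow, ← pow_mul, ← pow_mul]; ring_nf
    _ ≤ ((1 + A + B) ^ p) ^ n * (Real.exp (((2 * p * n : ℕ) : ℝ)) * (n ! : ℝ) ^ (2 * p)) :=
        mul_le_mul_of_nonneg_left hself (by positivity)
    _ = 1 * ((1 + A + B) ^ p * Real.exp (((2 * p : ℕ) : ℝ))) ^ n * (n ! : ℝ) ^ (2 * p) := by
        rw [one_mul, mul_pow, ← Real.exp_nat_mul]
        push_cast
        ring_nf

/-! ## Closure properties -/

/-- Domination preserves admissibility. -/
theorem mono {f g : ℕ → ℝ} (hfg : ∀ n : ℕ, 1 ≤ n → f n ≤ g n)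
    (hg : ∃ α C : ℝ, ∃ γ : ℕ, 0 ≤ α ∧ 0 ≤ C ∧ ∀ n : ℕ, 1 ≤ n → g n ≤ α * C ^ n * (n ! : ℝ) ^ γ) :
    ∃ α C : ℝ, ∃ γ : ℕ, 0 ≤ α ∧ 0 ≤ C ∧ ∀ n : ℕ, 1 ≤ n → f n ≤ α * C ^ n * (n ! : ℝ) ^ γ := by
  obtain ⟨α, C, γ, hα, hC, h⟩ := hg
  exact ⟨α, C, γ, hα, hC, fun n hn => (hfg n hn).trans (h n hn)⟩

/-- Products of admissible families, the second one non-negative, are admissible. -/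
theorem mul {f g : ℕ → ℝ} (hg0 : ∀ n : ℕ, 1 ≤ n → 0 ≤ g n)
    (hf : ∃ α C : ℝ, ∃ γ : ℕ, 0 ≤ α ∧ 0 ≤ C ∧ ∀ n : ℕ, 1 ≤ n → f n ≤ α * C ^ n * (n ! : ℝ) ^ γ)
    (hg : ∃ α C : ℝ, ∃ γ : ℕ, 0 ≤ α ∧ 0 ≤ C ∧ ∀ n : ℕ, 1 ≤ n → g n ≤ α * C ^ n * (n ! : ℝ) ^ γ) :
    ∃ α C : ℝ, ∃ γ : ℕ, 0 ≤ α ∧ 0 ≤ C ∧ ∀ n : ℕ, 1 ≤ n → f n * g n ≤ α * C ^ n * (n ! : ℝ) ^ γ := by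
  obtain ⟨α₁, C₁, γ₁, hα₁, hC₁, h₁⟩ := hf
  obtain ⟨α₂, C₂, γ₂, hα₂, hC₂, h₂⟩ := hg
  refine ⟨α₁ * α₂, C₁ * C₂, γ₁ + γ₂, mul_nonneg hα₁ hα₂, mul_nonneg hC₁ hC₂, fun n hn => ?_⟩
  have hb₁ : 0 ≤ α₁ * C₁ ^ n * (n ! : ℝ) ^ γ₁ := by positivity
  calc f n * g n ≤ (α₁ * C₁ ^ n * (n ! : ℝ) ^ γ₁) * (α₂ * C₂ ^ n * (n ! : ℝ) ^ γ₂) :=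
        mul_le_mul (h₁ n hn) (h₂ n hn) (hg0 n hn) hb₁
    _ = α₁ * α₂ * (C₁ * C₂) ^ n * (n ! : ℝ) ^ (γ₁ + γ₂) := by rw [mul_pow, pow_add]; ring

/-- Sums of admissible families are admissible. -/
theorem add {f g : ℕ → ℝ}
    (hf : ∃ α C : ℝ, ∃ γ : ℕ, 0 ≤ α ∧ 0 ≤ C ∧ ∀ n : ℕ, 1 ≤ n → f n ≤ α * C ^ n * (n ! : ℝ) ^ γ)
    (hg : ∃ α C : ℝ, ∃ γ : ℕ, 0 ≤ α ∧ 0 ≤ C ∧ ∀ n : ℕ, 1 ≤ n → g n ≤ α * C ^ n * (n ! : ℝ) ^ γ) :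
    ∃ α C : ℝ, ∃ γ : ℕ, 0 ≤ α ∧ 0 ≤ C ∧ ∀ n : ℕ, 1 ≤ n → f n + g n ≤ α * C ^ n * (n ! : ℝ) ^ γ := by
  obtain ⟨α₁, C₁, γ₁, hα₁, hC₁, h₁⟩ := hf
  obtain ⟨α₂, C₂, γ₂, hα₂, hC₂, h₂⟩ := hg
  refine ⟨α₁ + α₂, max C₁ C₂, max γ₁ γ₂, add_nonneg hα₁ hα₂, le_max_of_le_left hC₁, fun n hn => ?_⟩
  have hfac : (1 : ℝ) ≤ (n ! : ℝ) := by exact_mod_cast Nat.one_le_iff_ne_zero.2 (Nat.factorial_ne_zero n)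
  have hC : 0 ≤ max C₁ C₂ := le_max_of_le_left hC₁
  have e₁ : α₁ * C₁ ^ n * (n ! : ℝ) ^ γ₁ ≤ α₁ * (max C₁ C₂) ^ n * (n ! : ℝ) ^ (max γ₁ γ₂) :=
    mul_le_mul (mul_le_mul_of_nonneg_left (pow_le_pow_left₀ hC₁ (le_max_left _ _) n) hα₁)
      (pow_le_pow_right₀ hfac (le_max_left _ _)) (by positivity) (by positivity)
  have e₂ : α₂ * C₂ ^ n * (n ! : ℝ) ^ γ₂ ≤ α₂ * (max C₁ C₂) ^ n * (n ! : ℝ) ^ (max γ₁ γ₂) :=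
    mul_le_mul (mul_le_mul_of_nonneg_left (pow_le_pow_left₀ hC₂ (le_max_right _ _) n) hα₂)
      (pow_le_pow_right₀ hfac (le_max_right _ _)) (by positivity) (by positivity)
  calc f n + g n ≤ α₁ * C₁ ^ n * (n ! : ℝ) ^ γ₁ + α₂ * C₂ ^ n * (n ! : ℝ) ^ γ₂ := add_le_add (h₁ n hn) (h₂ n hn)
    _ ≤ α₁ * (max C₁ C₂) ^ n * (n ! : ℝ) ^ (max γ₁ γ₂) + α₂ * (max C₁ C₂) ^ n * (n ! : ℝ) ^ (max γ₁ γ₂) :=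
        add_le_add e₁ e₂
    _ = (α₁ + α₂) * (max C₁ C₂) ^ n * (n ! : ℝ) ^ (max γ₁ γ₂) := by ring

/-- Scaling by a non-negative constant preserves admissibility. -/
theorem const_mul {f : ℕ → ℝ} {a : ℝ} (ha : 0 ≤ a)
    (hf : ∃ α C : ℝ, ∃ γ : ℕ, 0 ≤ α ∧ 0 ≤ C ∧ ∀ n : ℕ, 1 ≤ n → f n ≤ α * C ^ n * (n ! : ℝ) ^ γ) :
    ∃ α C : ℝ, ∃ γ : ℕ, 0 ≤ α ∧ 0 ≤ C ∧ ∀ n : ℕ, 1 ≤ n → a * f n ≤ α * C ^ n * (n ! : ℝ) ^ γ := by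
  obtain ⟨α, C, γ, hα, hC, h⟩ := hf
  refine ⟨a * α, C, γ, mul_nonneg ha hα, hC, fun n hn => ?_⟩
  calc a * f n ≤ a * (α * C ^ n * (n ! : ℝ) ^ γ) := mul_le_mul_of_nonneg_left (h n hn) ha
    _ = a * α * C ^ n * (n ! : ℝ) ^ γ := by ring

/-- **Real-exponent form** (the shape of `WhitneyPkg`): an admissible family is bounded by `α Cⁿ (n!)^γ` with `γ : ℝ`,
`0 ≤ α, C, γ`. -/
theorem exists_rpow_form {f : ℕ → ℝ}
    (hf : ∃ α C : ℝ, ∃ γ : ℕ, 0 ≤ α ∧ 0 ≤ C ∧ ∀ n : ℕ, 1 ≤ n → f n ≤ α * C ^ n * (n ! : ℝ) ^ γ) :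
    ∃ α C γ : ℝ, 0 ≤ α ∧ 0 ≤ C ∧ 0 ≤ γ ∧ ∀ n : ℕ, 1 ≤ n → f n ≤ α * C ^ n * (n ! : ℝ) ^ γ := by
  obtain ⟨α, C, γ, hα, hC, h⟩ := hf
  refine ⟨α, C, (γ : ℝ), hα, hC, Nat.cast_nonneg γ, fun n hn => ?_⟩
  rw [Real.rpow_natCast]
  exact h n hn

end Summit.QuantumFields.YangMills.Cruxes.AtomicCalibrationR.Admissible

end
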